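import Summits.KontsevichZagierPeriods.KontsevichZagierPeriods.Theorems.SoloInformedSectorMap
import Summits.KontsevichZagierPeriods.KontsevichZagierPeriods.Theorems.SoloInformedLeafTransport
import HarnessLib

/-!
# Fans of sectors: presentability on a fan from presentability on consecutive sectors

Solo programme `solo-KontsevichZagierPeriods-informed`, session s111, step (γ-8a) of the kernel
project PRES-RAT(2) (the corner step of the vertex recursion).

The **fan** `Fan(κ, B) = {0 < z₀ < κ, 0 < z₁ < B z₀}` is, up to the null rays `z₁ = h z₀`
(`h ∈ H`), the disjoint union of the sectors `S(κ, a, b − a)` over the *consecutive pairs*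
`a < b` of a finite slope set `H ⊆ K` with `0, B ∈ H ⊆ [0, B]`.  Hence (rule (1) with null
overlaps and null complements) a function presentable on every `Ω ∩ S(κ, a, b − a)` is
presentable on `Ω ∩ Fan(κ, B)`; the same holds for the swapped fan `{0 < z₁ < κ, 0 < z₀ < B z₁}`
with swapped sectors.  All slopes live in the coefficient field `K`, compared through
`algebraMap K ℝ`; consecutive pairs are found with `Finset.exists_max_image`.

References: Kontsevich–Zagier, *Periods* (2001), §1.2 rule (1).
-/

noncomputable section

open scoped BigOperators
open MeasureTheory Set
open Literature.NumberTheory.Transcendental Literature.NumberTheory.Transcendental.KZ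
open Literature.ModelTheory.ExponentialFields (IsSemialgebraic isSemialgebraic_univ)

namespace Summit.KontsevichZagierPeriods.KontsevichZagierPeriods.Theorems

variable {K : Type*} [Field K] [Algebra K ℝ]

/-! ### Fans and sectors -/

/-- The open fan `{0 < z₀ < κ, 0 < z₁ < B z₀}` of slopes in `(0, B)`. [this work] -/
def soloInformedFan (κ B : ℝ) : Set (Fin 2 → ℝ) :=
  {z | 0 < z 0 ∧ z 0 < κ ∧ 0 < z 1 ∧ z 1 < B * z 0}

/-- Membership in the sector `S(κ, a, b − a)` (`a < b`): `0 < z₀ < κ` and `a z₀ < z₁ < b z₀`. -/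
theorem soloInformed_mem_sector_iff {κ a b : ℝ} (hab : a < b) {z : Fin 2 → ℝ} :
    z ∈ soloInformedSector κ a (b - a) ↔ 0 < z 0 ∧ z 0 < κ ∧ a * z 0 < z 1 ∧ z 1 < b * z 0 := by
  constructor
  · rintro ⟨h0, hκ, h1, h2⟩
    have hd : 0 < (b - a) * z 0 := mul_pos (sub_pos.2 hab) h0
    rw [lt_div_iff₀ hd, zero_mul, sub_pos] at h1
    rw [div_lt_one hd] at h2
    exact ⟨h0, hκ, h1, by linarith⟩
  · rintro ⟨h0, hκ, h1, h2⟩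
    have hd : 0 < (b - a) * z 0 := mul_pos (sub_pos.2 hab) h0
    exact ⟨h0, hκ, (lt_div_iff₀ hd).2 (by rw [zero_mul, sub_pos]; exact h1),
      (div_lt_one hd).2 (by linarith)⟩

/-- The fan is `ℚ`-semialgebraic for `κ, B ∈ K`. -/
theorem soloInformed_isSemialgebraic_fan (hK : ∀ c : K, IsAlgebraic ℚ (algebraMap K ℝ c))
    (κ B : K) : IsSemialgebraic ℚ (soloInformedFan (algebraMap K ℝ κ) (algebraMap K ℝ B)) := by
  have hu : IsSemialgebraic ℚ (univ : Set (Fin 2 → ℝ)) := isSemialgebraic_univ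
  have e1 : IsSemialgebraic ℚ {x : Fin 2 → ℝ | x ∈ univ ∧
      (MvPolynomial.aeval x (-MvPolynomial.X 0 : MvPolynomial (Fin 2) K) : ℝ) < 0} :=
    (soloInformed_isSemialgebraicFunOn_aevalK hK hu _).isSemialgebraic_sep_neg
  have e2 : IsSemialgebraic ℚ {x : Fin 2 → ℝ | x ∈ univ ∧
      (MvPolynomial.aeval x (MvPolynomial.X 0 - MvPolynomial.C κ : MvPolynomial (Fin 2) K) : ℝ)
        < 0} :=
    (soloInformed_isSemialgebraicFunOn_aevalK hK hu _).isSemialgebraic_sep_neg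
  have e3 : IsSemialgebraic ℚ {x : Fin 2 → ℝ | x ∈ univ ∧
      (MvPolynomial.aeval x (-MvPolynomial.X 1 : MvPolynomial (Fin 2) K) : ℝ) < 0} :=
    (soloInformed_isSemialgebraicFunOn_aevalK hK hu _).isSemialgebraic_sep_neg
  have e4 : IsSemialgebraic ℚ {x : Fin 2 → ℝ | x ∈ univ ∧
      (MvPolynomial.aeval x (MvPolynomial.X 1 - MvPolynomial.C B * MvPolynomial.X 0 :
        MvPolynomial (Fin 2) K) : ℝ) < 0} :=
    (soloInformed_isSemialgebraicFunOn_aevalK hK hu _).isSemialgebraic_sep_neg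
  convert ((e1.inter e2).inter e3).inter e4 using 1
  ext z
  simp only [soloInformedFan, mem_setOf_eq, mem_inter_iff, mem_univ, true_and, map_neg,
    MvPolynomial.aeval_X, map_sub, map_mul, MvPolynomial.aeval_C, neg_lt_zero, sub_lt_zero]
  tauto

/-- The swap preimage of a `ℚ`-semialgebraic set is `ℚ`-semialgebraic. -/
theorem soloInformed_isSemialgebraic_swap_preimage {Ω : Set (Fin 2 → ℝ)}
    (hΩ : IsSemialgebraic ℚ Ω) :
    IsSemialgebraic ℚ ((fun z : Fin 2 → ℝ => (![z 1, z 0] : Fin 2 → ℝ)) ⁻¹' Ω) := by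
  convert hΩ.preimage_comp (R := ℝ) (Equiv.swap (0 : Fin 2) 1) using 1
  ext z
  simp only [mem_preimage]
  have : (z ∘ (Equiv.swap (0 : Fin 2) 1)) = ![z 1, z 0] := by
    funext i; fin_cases i <;> rfl
  rw [this]

/-! ### The fan lemma -/

/-- **The fan lemma.**  Let `H ⊆ K` be a finite slope set containing `0` and `B`, with
`0 ≤ h ≤ B` for all `h ∈ H`.  If `f` is presentable on `Ω ∩ S(κ, a, b − a)` for every consecutive
pair `a < b` of `H`, then `f` is presentable on `Ω ∩ Fan(κ, B)`. [this work] -/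
theorem soloInformed_presOn_inter_fan (hK : ∀ c : K, IsAlgebraic ℚ (algebraMap K ℝ c))
    {Ω : Set (Fin 2 → ℝ)} (hΩ : IsSemialgebraic ℚ Ω) {f : (Fin 2 → ℝ) → ℝ} (κ : K) {B : K}
    {H : Finset K} (h0 : (0 : K) ∈ H) (hB : B ∈ H)
    (hle : ∀ a ∈ H, 0 ≤ algebraMap K ℝ a ∧ algebraMap K ℝ a ≤ algebraMap K ℝ B)
    (hsec : ∀ a ∈ H, ∀ b ∈ H, algebraMap K ℝ a < algebraMap K ℝ b →
      (∀ c ∈ H, ¬ (algebraMap K ℝ a < algebraMap K ℝ c ∧ algebraMap K ℝ c < algebraMap K ℝ b)) →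
      SoloInformedPresOn (Ω ∩ soloInformedSector (algebraMap K ℝ κ) (algebraMap K ℝ a)
        (algebraMap K ℝ (b - a))) f) :
    SoloInformedPresOn (Ω ∩ soloInformedFan (algebraMap K ℝ κ) (algebraMap K ℝ B)) f := by
  classical
  set e := algebraMap K ℝ with he
  have einj : Function.Injective e := (algebraMap K ℝ).injective
  -- consecutive pairs
  set CP : Finset (K × K) := (H ×ˢ H).filter (fun p => e p.1 < e p.2 ∧
    ∀ c ∈ H, ¬ (e p.1 < e c ∧ e c < e p.2)) with hCP
  have hmemCP : ∀ p : K × K, p ∈ CP ↔ (p.1 ∈ H ∧ p.2 ∈ H) ∧ e p.1 < e p.2 ∧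
      ∀ c ∈ H, ¬ (e p.1 < e c ∧ e c < e p.2) := fun p => by
    rw [hCP, Finset.mem_filter, Finset.mem_product]
  -- the pieces
  set S' : K × K → Set (Fin 2 → ℝ) := fun p =>
    Ω ∩ soloInformedSector (e κ) (e p.1) (e (p.2 - p.1)) with hS'
  have hmemS' : ∀ p : K × K, e p.1 < e p.2 → ∀ z, z ∈ S' p ↔
      z ∈ Ω ∧ 0 < z 0 ∧ z 0 < e κ ∧ e p.1 * z 0 < z 1 ∧ z 1 < e p.2 * z 0 := fun p hp z => by
    change z ∈ Ω ∩ _ ↔ _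
    rw [mem_inter_iff, map_sub, soloInformed_mem_sector_iff hp]
  set S : ↥CP → Set (Fin 2 → ℝ) := fun p => S' p.1 with hS
  have hSsa : ∀ p, IsSemialgebraic ℚ (S p) := fun p =>
    hΩ.inter (soloInformed_isSemialgebraic_sector hK κ _ _)
  -- distinct consecutive sectors are disjoint
  have hdisj : ∀ p q : ↥CP, p ≠ q → S p ∩ S q = ∅ := by
    intro p q hpq
    obtain ⟨⟨hp1, hp2⟩, hplt, hpc⟩ := (hmemCP p.1).1 p.2
    obtain ⟨⟨hq1, hq2⟩, hqlt, hqc⟩ := (hmemCP q.1).1 q.2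
    refine eq_empty_iff_forall_notMem.2 fun z ⟨hzp, hzq⟩ => hpq ?_
    obtain ⟨-, hz0, -, hpa, hpb⟩ := (hmemS' p.1 hplt z).1 hzp
    obtain ⟨-, -, -, hqa, hqb⟩ := (hmemS' q.1 hqlt z).1 hzq
    have ha : e p.1.1 = e q.1.1 := by
      rcases lt_trichotomy (e p.1.1) (e q.1.1) with h | h | h
      · have hle' : e p.1.2 ≤ e q.1.1 := not_lt.1 fun h' => hpc q.1.1 hq1 ⟨h, h'⟩
        nlinarith
      · exact h
      · have hle' : e q.1.2 ≤ e p.1.1 := not_lt.1 fun h' => hqc p.1.1 hp1 ⟨h, h'⟩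
        nlinarith
    have hb : e p.1.2 = e q.1.2 := by
      rcases lt_trichotomy (e p.1.2) (e q.1.2) with h | h | h
      · exact absurd ⟨ha ▸ hplt, h⟩ (hqc p.1.2 hp2)
      · exact h
      · exact absurd ⟨ha.symm ▸ hqlt, h⟩ (hpc q.1.2 hq2)
    exact Subtype.ext (Prod.ext (einj ha) (einj hb))
  have hnull : ∀ p q : ↥CP, p ≠ q → volume (S p ∩ S q) = 0 := fun p q hpq => by
    rw [hdisj p q hpq, measure_empty]
  -- rule (1) over the pieces
  have hU : SoloInformedPresOn (⋃ p, S p) f :=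
    soloInformed_presOn_of_iUnion S hSsa hnull rfl fun p => by
      obtain ⟨⟨hp1, hp2⟩, hplt, hpc⟩ := (hmemCP p.1).1 p.2
      exact hsec _ hp1 _ hp2 hplt hpc
  -- the union of the pieces is semialgebraic, inside the fan, and exhausts it up to null rays
  have hUeq : (⋃ p, S p) = ⋃ p ∈ CP, S' p := by
    ext z
    simp only [mem_iUnion]
    exact ⟨fun ⟨p, hz⟩ => ⟨p.1, p.2, hz⟩, fun ⟨p, hp, hz⟩ => ⟨⟨p, hp⟩, hz⟩⟩
  have hUsa : IsSemialgebraic ℚ (⋃ p, S p) := by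
    rw [hUeq]
    exact IsSemialgebraic.biUnion CP S' fun p _ =>
      hΩ.inter (soloInformed_isSemialgebraic_sector hK κ _ _)
  have hUsub : (⋃ p, S p) ⊆ Ω ∩ soloInformedFan (e κ) (e B) := by
    intro z hz
    obtain ⟨p, hz⟩ := mem_iUnion.1 hz
    obtain ⟨⟨hp1, hp2⟩, hplt, -⟩ := (hmemCP p.1).1 p.2
    obtain ⟨hzΩ, hz0, hzκ, hpa, hpb⟩ := (hmemS' p.1 hplt z).1 hz
    refine ⟨hzΩ, hz0, hzκ, ?_, ?_⟩
    · exact lt_of_le_of_lt (mul_nonneg (hle _ hp1).1 hz0.le) hpa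
    · exact lt_of_lt_of_le hpb (mul_le_mul_of_nonneg_right (hle _ hp2).2 hz0.le)
  have hdiff : (Ω ∩ soloInformedFan (e κ) (e B)) \ (⋃ p, S p) ⊆
      ⋃ c ∈ H, {z : Fin 2 → ℝ | z 1 = e c * z 0} := by
    rintro z ⟨⟨hzΩ, hz0, hzκ, hz1, hzB⟩, hzU⟩
    by_contra hray
    simp only [mem_iUnion, mem_setOf_eq, not_exists] at hray
    -- the last slope below and the first slope above `z`
    obtain ⟨a, haH, hamax⟩ := Finset.exists_max_image (H.filter fun c => e c * z 0 < z 1)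
      (fun c => e c) ⟨0, Finset.mem_filter.2 ⟨h0, by rw [map_zero, zero_mul]; exact hz1⟩⟩
    obtain ⟨b, hbH, hbmin⟩ := Finset.exists_min_image (H.filter fun c => z 1 < e c * z 0)
      (fun c => e c) ⟨B, Finset.mem_filter.2 ⟨hB, hzB⟩⟩
    obtain ⟨haH, ha⟩ := Finset.mem_filter.1 haH
    obtain ⟨hbH, hb⟩ := Finset.mem_filter.1 hbH
    have hab : e a < e b := by
      by_contra h
      have : e b * z 0 ≤ e a * z 0 := mul_le_mul_of_nonneg_right (not_lt.1 h) hz0.le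
      linarith
    have hcons : ∀ c ∈ H, ¬ (e a < e c ∧ e c < e b) := by
      rintro c hc ⟨hac, hcb⟩
      rcases lt_trichotomy (e c * z 0) (z 1) with h | h | h
      · exact absurd (hamax c (Finset.mem_filter.2 ⟨hc, h⟩)) (not_le.2 hac)
      · exact hray c hc h.symm
      · exact absurd (hbmin c (Finset.mem_filter.2 ⟨hc, h⟩)) (not_le.2 hcb)
    refine hzU (mem_iUnion.2 ⟨⟨(a, b), (hmemCP _).2 ⟨⟨haH, hbH⟩, hab, hcons⟩⟩, ?_⟩)
    exact (hmemS' (a, b) hab z).2 ⟨hzΩ, hz0, hzκ, ha, hb⟩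
  have hvol : volume ((Ω ∩ soloInformedFan (e κ) (e B)) \ ⋃ p, S p) = 0 :=
    measure_mono_null hdiff ((measure_biUnion_null_iff H.countable_toSet).2
      fun c _ => soloInformed_volume_ray _)
  exact soloInformed_presOn_of_subset_null hUsa hUsub hvol hU

/-- **The swapped fan lemma.**  With the same slope data, if `f ∘ swap` is presentable on
`swap⁻¹ Ω ∩ S(κ, a, b − a)` for every consecutive pair, then `f` is presentable on
`Ω ∩ swap⁻¹ Fan(κ, B)`. [this work] -/
theorem soloInformed_presOn_inter_swapFan (hK : ∀ c : K, IsAlgebraic ℚ (algebraMap K ℝ c))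
    {Ω : Set (Fin 2 → ℝ)} (hΩ : IsSemialgebraic ℚ Ω) {f : (Fin 2 → ℝ) → ℝ} (κ : K) {B : K}
    {H : Finset K} (h0 : (0 : K) ∈ H) (hB : B ∈ H)
    (hle : ∀ a ∈ H, 0 ≤ algebraMap K ℝ a ∧ algebraMap K ℝ a ≤ algebraMap K ℝ B)
    (hsec : ∀ a ∈ H, ∀ b ∈ H, algebraMap K ℝ a < algebraMap K ℝ b →
      (∀ c ∈ H, ¬ (algebraMap K ℝ a < algebraMap K ℝ c ∧ algebraMap K ℝ c < algebraMap K ℝ b)) →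
      SoloInformedPresOn (((fun z : Fin 2 → ℝ => (![z 1, z 0] : Fin 2 → ℝ)) ⁻¹' Ω) ∩
        soloInformedSector (algebraMap K ℝ κ) (algebraMap K ℝ a) (algebraMap K ℝ (b - a)))
        fun z => f ![z 1, z 0]) :
    SoloInformedPresOn (Ω ∩ (fun z : Fin 2 → ℝ => (![z 1, z 0] : Fin 2 → ℝ)) ⁻¹'
      soloInformedFan (algebraMap K ℝ κ) (algebraMap K ℝ B)) f := by
  have h1 := soloInformed_presOn_inter_fan hK (soloInformed_isSemialgebraic_swap_preimage hΩ)
    κ h0 hB hle hsec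
  refine soloInformed_presOn_of_swap (hΩ.inter (soloInformed_isSemialgebraic_swap_preimage
    (soloInformed_isSemialgebraic_fan hK κ B))) ?_
  have hsw : ∀ z : Fin 2 → ℝ, (![(![z 1, z 0] : Fin 2 → ℝ) 1, (![z 1, z 0] : Fin 2 → ℝ) 0] :
      Fin 2 → ℝ) = z := fun z => by
    funext i; fin_cases i <;> rfl
  have heq : (fun z : Fin 2 → ℝ => (![z 1, z 0] : Fin 2 → ℝ)) ⁻¹' (Ω ∩
      (fun z : Fin 2 → ℝ => (![z 1, z 0] : Fin 2 → ℝ)) ⁻¹'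
        soloInformedFan (algebraMap K ℝ κ) (algebraMap K ℝ B)) =
      ((fun z : Fin 2 → ℝ => (![z 1, z 0] : Fin 2 → ℝ)) ⁻¹' Ω) ∩
        soloInformedFan (algebraMap K ℝ κ) (algebraMap K ℝ B) := by
    ext z
    simp only [preimage_inter, mem_inter_iff, mem_preimage, hsw]
  rw [heq]
  exact h1

end Summit.KontsevichZagierPeriods.KontsevichZagierPeriods.Theorems
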